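import Summits.ResolutionOfSingularities.ResolutionOfSingularities.Theorems.EquisingularLiftEquisingularLiftNatTowerBPairRoundOfFact
import Summits.ResolutionOfSingularities.ResolutionOfSingularities.Theorems.EquisingularLiftEquisingularLiftNatTowerBDoublePrimePairArm
import Summits.ResolutionOfSingularities.ResolutionOfSingularities.Theorems.EquisingularLiftEquisingularLiftNatTowerBDoublePrimeDriver
import Summits.ResolutionOfSingularities.ResolutionOfSingularities.Theorems.EquisingularLiftEquisingularLiftNatBoundaryWitnessedCentre
import Summits.ResolutionOfSingularities.ResolutionOfSingularities.Theorems.EquisingularLiftEquisingularLiftNatTowerAssemblyV9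
import HarnessLib

/-!
# [OURS · L1 W4.5(b) · EL♮(3) · T23-A″] HSUB″(ReachTowerB″)₃ — THE ENGINE V10″ OF RUNG DEF-TOWER-B″ (`stub_elnat_defTowerBDoublePrimePointResolutionThree`,
# registration = ONE engine-green swap, desk R20 (i) «the THIRTIETH»)

res-L1-w45b-stub-2 g12, desk R20 (ii) («stub-2 … then V10″») and res-L1-w45b-stub-4's ENGINE WORD `T23Adprime-ENGINE-WORD.md` 16d03a46d50c8ccd §4. OURS; NOT a
statement of any manuscript; AI-written, weaker than expert review. No `sorry`; standard axioms; DEF-FREE; `--supports stmt-ResolutionOfSingularities-20148 --as helper`.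
= V10′ `hsub_reachTowerBPrime_of_fact` (…NatTowerBPrimeAssembly p612834) VERBATIM (adapted copy) except: the conclusion reads `ReachTowerBDoublePrime`
(res-L1-w45b-lead-2 …NatTowerRoundBDoublePrimeDefs p616048: the round step `TowerRoundBDoublePrime` admits PAIR ROUNDS — centre the reduced crossing curve of
two retained members), the driver is lead-2's `hsub_reachTowerBDoublePrime_of_invariant` (…NatTowerBDoublePrimeDriver), the two old round disjuncts carry the
idle witness `W = Hst` (B″ transports ⇒ B′ transports, `roundTransportOKPrime_of_roundTransportOKDoublePrime_self`) and route to the A′ round layers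
`Tower.invB_embRound_of_fact_anyPrime` / `Tower.invB_coneRound_of_anyPrime` as before, and the NEW third disjunct routes through the menu dispatch
`Tower.invB_pairDisjunct_of_supplier` (…NatTowerBDoublePrimePairArm) to stub-4's round-of-fact″ `Tower.invB_pairRound_of_fact` (…NatTowerBPairRoundOfFact
p616482, over `Tower.invB_pairRoundCore` p615801) whose section hypotheses `hA1`/`hA2` are the (A″-1)/(A″-2) v2 bricks `isRegular_subscheme_sup_of_trace_crossing` /
`flat_subschemeι_sup_of_trace_crossing` (…NatBoundaryWitnessedCentre p616010) BY NAME. Base / point / curve / final clauses and the named stand-in S7′ `hBaseKCL`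
are V10's. [cite: GortzWedhorn2020, Prop. 13.91 and (13.19)]
-/

set_option linter.dupNamespace false -- mandated namespace `Summit.<Summit>.<Problem>` of this single-conjunct summit
set_option linter.overlappingInstances false -- signatures carry `[IsDomain O] [IsDiscreteValuationRing O]`

noncomputable section

open CategoryTheory CategoryTheory.Limits AlgebraicGeometry TopologicalSpace Topology IsLocalRing
open Literature.AlgebraicGeometry.Resolution
open AlgebraicGeometry.Scheme.IdealSheafData
open Literature.AlgebraicGeometry.Morphisms (ProjCech.PP ProjCech.toSpec)
open Summit.ResolutionOfSingularities.ResolutionOfSingularities.Theses.EquisingularLift.Split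
open Summit.ResolutionOfSingularities.ResolutionOfSingularities.Cruxes.EquisingularLift.StrataSplit

namespace Summit.ResolutionOfSingularities.ResolutionOfSingularities.Cruxes.EquisingularLiftNat.Sections

/-- **HSUB″(ReachTowerB″)₃ — the engine V10″ of DEF-TOWER-B″** (module docstring). [cite: GortzWedhorn2020, Prop. 13.91 and (13.19)]
[cite: Liu2002, §8.1 and Thm. 8.1.19] [OURS · L1 W4.5b · T23-A″ engine] toward `stub_elnat_defTowerBDoublePrimePointResolutionThree`; NOT a statement of the manuscript. -/
theorem hsub_reachTowerBDoublePrime_of_fact (k : Type) [Field k] [IsAlgClosed k]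
    (O : Type) [CommRing O] [IsDomain O] [IsDiscreteValuationRing O] [IsAdicComplete (IsLocalRing.maximalIdeal O) O]
    [IsAlgClosed (IsLocalRing.ResidueField O)] (θ : O →+* k) (hθ : Function.Surjective θ)
    (P : Scheme.{0}) (q : P ⟶ Spec (.of O)) (Y : Set P) (Ch : ∀ X' : Scheme.{0}, (X' ⟶ P) → Set X' → Prop)
    (hChStep : ∀ (X' X'' : Scheme.{0}) (σ' : X' ⟶ P) (S' : Set X') (C : X'.IdealSheafData) (τ : X'' ⟶ X'),
      Ch X' σ' S' → IsBlowup τ C → Scheme.IsRegular C.subscheme → Flat (C.subschemeι ≫ σ' ≫ q) →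
      σ' '' (C.support : Set X') ⊆ {y | ¬ IsGenericPoint y Y} → (C.support : Set X') ∩ (σ' ≫ q) ⁻¹' {IsLocalRing.closedPoint O} ⊆ S' →
      Ch X'' (τ ≫ σ') (closure (τ ⁻¹' (S' \ (C.support : Set X')))))
    (hChSplit : ∀ (X' : Scheme.{0}) (σ' : X' ⟶ P) (S' : Set X'), Ch X' σ' S' → Chain P Y X' σ' S')
    (hYsp : Y ⊆ q ⁻¹' {IsLocalRing.closedPoint O}) (hYirr : IsIrreducible Y) (hYcl : IsClosed Y) (hPint : IsIntegral P)
    (hPnoeth : IsLocallyNoetherian P) (hPreg : Scheme.IsRegular P) (hqprop : IsProper q) (hqsm : SmoothOfRelativeDimension 3 q)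
    (X' : Scheme.{0}) (σ' : X' ⟶ P) (S' : Set X') (hCh' : Ch X' σ' S') (hX'int : IsIntegral X') (hX'noeth : IsLocallyNoetherian X')
    (hX'reg : Scheme.IsRegular X') (hX'dom : IsDominant (σ' ≫ q)) (F₁ : Scheme.{0}) (hF₁ : IsIntegral F₁) (j : F₁ ⟶ X')
    (t : F₁ ⟶ Spec (.of k)) (hsq : IsPullback j t (σ' ≫ q) (Spec.map (CommRingCat.ofHom θ))) (T₁ : Set F₁) (hT₁cl : IsClosed T₁)
    (hT₁irr : IsIrreducible T₁) (hjT₁ : j '' T₁ = S') (x : F₁) (hx : IsClosed ({x} : Set F₁)) (U : X'.Opens)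
    (hU : Smooth (U.ι ≫ σ' ≫ q)) (s : Spec (.of O) ⟶ X') (hs : s ≫ σ' ≫ q = 𝟙 _) (hsU : s (IsLocalRing.closedPoint O) ∈ U)
    (hsx : s (IsLocalRing.closedPoint O) = j x)
    (hdim : ringKrullDim (X'.presheaf.stalk (s (IsLocalRing.closedPoint O))) = ((3 + 1 : ℕ) : WithBot ℕ∞))
    (hxreg : IsRegularLocalRing (F₁.presheaf.stalk x)) (hsoff : ∀ c ∈ (s.ker.support : Set X'), ¬ IsGenericPoint (σ' c) Y)
    (X₁ : Scheme.{0}) (τ₁ : X₁ ⟶ X') (hτ₁ : IsBlowup τ₁ s.ker) (hX₁int : IsIntegral X₁) (hX₁noeth : IsLocallyNoetherian X₁)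
    (hX₁reg : Scheme.IsRegular X₁) (hX₁dom : IsDominant ((τ₁ ≫ σ') ≫ q)) (F₂ : Scheme.{0}) (hF₂ : IsIntegral F₂) (υ : F₂ ⟶ F₁)
    (hυ : IsBlowup υ (vanishingIdeal (⟨{x}, hx⟩ : Closeds F₁))) (j₂ : F₂ ⟶ X₁) (t₂ : F₂ ⟶ Spec (.of k))
    (hsq₂ : IsPullback j₂ t₂ ((τ₁ ≫ σ') ≫ q) (Spec.map (CommRingCat.ofHom θ))) (hcomm : j₂ ≫ τ₁ = υ ≫ j)
    (hcarrier : (s.ker.comap τ₁).comap j₂ = (vanishingIdeal (⟨{x}, hx⟩ : Closeds F₁)).comap υ)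
    (hirr₂ : IsIrreducible (closure (υ ⁻¹' (T₁ \ {x})))) (hCh₁ : Ch X₁ (τ₁ ≫ σ') (j₂ '' closure (υ ⁻¹' (T₁ \ {x}))))
    -- ===================== THE FACT AND THE NAMED STAND-INS =====================
    -- (T-k) the embedded-curve lift at every stage / exceptional surface over `q` (res-L1-w45b-lead-2 …NatTowerRoundFourDefs p594791)
    (hFact : EmbeddedCurveLift O k θ P q)
    -- (S7′) B9 at the `ConeForm` seed with the LOCALIZED shadow trace (vii-loc) (res-type-100: `…NatConeFormConstants` → KCL twin → `hBaseKCL`)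
    (hBaseKCL : ∀ W : Set F₁, x ∈ W → ¬ (υ ⁻¹' {x} ⊆ closure (υ ⁻¹' (W \ {x}))) →
        (∃ U₁ : F₁.affineOpens, x ∈ (U₁ : F₁.Opens) ∧
          ((vanishingIdeal (⟨closure W, isClosed_closure⟩ : Closeds F₁)).ideal U₁).IsPrincipal) →
        ConeForm F₁ x W →
        TCPlus.InvKCL O k θ P q Y Ch W F₂ (𝟙 F₂) (closure (υ ⁻¹' (T₁ \ {x}))) (υ ⁻¹' {x} ∩ closure (υ ⁻¹' (W \ {x})))
          (closure (υ ⁻¹' (W \ {x}))) false) :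
    -- ===================== THE CONCLUSION OF HSUB″(ReachTowerB″)₃ (T23-A″) =====================
    ∀ (F' : Scheme.{0}) (β : F' ⟶ F₂) (T' : Set F'), ReachTowerBDoublePrime F₁ F₂ υ x (closure (υ ⁻¹' (T₁ \ {x}))) F' β T' →
      ∃ (X₉ : Scheme.{0}) (σ₉ : X₉ ⟶ P) (S₉ : Set X₉) (j₉ : F' ⟶ X₉) (t₉ : F' ⟶ Spec (.of k)),
        Ch X₉ σ₉ S₉ ∧ IsIntegral X₉ ∧ IsLocallyNoetherian X₉ ∧ Scheme.IsRegular X₉ ∧ IsDominant (σ₉ ≫ q) ∧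
        IsPullback j₉ t₉ (σ₉ ≫ q) (Spec.map (CommRingCat.ofHom θ)) ∧ j₉ '' T' = S₉ ∧ IsClosed T' ∧ IsIrreducible T' ∧ IsIntegral F' := by
  classical
  haveI := hPint; haveI := hqprop; haveI := hqsm; haveI := hX'int; haveI := hX'noeth; haveI := hF₁; haveI := hX₁int; haveI := hX₁noeth
  haveI := hF₂
  -- the exceptional-surface datum of the ₅ engine: `O`-FLATNESS of the upstairs model of the running exceptional surface
  let FE : Tower.RuledDatum P := fun _ _ _ _ _ _ _ _ _ σ _ 𝓔 => Flat (𝓔.subschemeι ≫ σ ≫ q)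
  -- its BIRTH at a centre blow-up (…CentreBlowupFlatExceptional) and its TRANSPORT along an isomorphism over the step
  have hFEbirth : ∀ {X X'' : Scheme.{0}} [IsLocallyNoetherian X] (σ : X ⟶ P) (C : X.IdealSheafData) (τ : X'' ⟶ X),
      Scheme.IsRegular X → Scheme.IsRegular C.subscheme → Flat (C.subschemeι ≫ σ ≫ q) → IsBlowup τ C →
      Flat ((C.comap τ).subschemeι ≫ (τ ≫ σ) ≫ q) := by
    intro X X'' _ σ C τ hXreg hCreg hCflat hτ
    rw [Category.assoc]
    exact flat_exceptional_of_isBlowup_regularCentre O X X'' (σ ≫ q) C hXreg hCreg hCflat τ hτ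
  have hFEiso : ∀ {X X'' : Scheme.{0}} (σ : X ⟶ P) (I : X.IdealSheafData) (τ : X'' ⟶ X) (I'' : X''.IdealSheafData),
      (∃ e : I''.subscheme ≅ I.subscheme, e.hom ≫ I.subschemeι = I''.subschemeι ≫ τ) →
      Flat (I.subschemeι ≫ σ ≫ q) → Flat (I''.subschemeι ≫ (τ ≫ σ) ≫ q) := by
    intro X X'' σ I τ I'' he hflat
    obtain ⟨e, he⟩ := he
    have heq : I''.subschemeι ≫ (τ ≫ σ) ≫ q = e.hom ≫ I.subschemeι ≫ σ ≫ q := by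
      rw [← Category.assoc e.hom, he]; simp only [Category.assoc]
    rw [heq]
    infer_instance
  -- the special fibre of `F₂` over `x`
  have hEx : IsClosed (υ ⁻¹' ({x} : Set F₁)) := hx.preimage υ.continuous
  -- input (c)'s carrier datum (…NatTowerEmbRoundOfFact, V7's `hcarOf` verbatim)
  have hcarOfINV := Tower.hcar_of_innerInv O k θ hθ P q Y hYirr hYcl Ch hChSplit (F₁ := F₁) (F₂ := F₂)
  have hnoethOfINV := Tower.isLocallyNoetherian_of_innerInv O k θ hθ P q Y Ch (F₁ := F₁) (F₂ := F₂)
  -- the iso-invariance of the datum `FE`, in the shape the B point clauses consume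
  have hFEisoC : ∀ {F₉ : Scheme.{0}} (Z₉ : Set F₉) (hZ₉ : IsClosed Z₉) {F₁₀ : Scheme.{0}} (υ' : F₁₀ ⟶ F₉),
      ∀ (G₀ G₀' : Scheme.{0}) (γ₀ : G₀ ⟶ F₁₀) (γ₀' : G₀' ⟶ F₁₀) (E₀ : Set G₀) (E₀' : Set G₀') (X₀ X₀'' : Scheme.{0})
        (σ₀ : X₀ ⟶ P) (j₀ : G₀ ⟶ X₀) (j₀' : G₀' ⟶ X₀'') (𝓔₀ : X₀.IdealSheafData) (τ₀ : X₀'' ⟶ X₀),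
      (∃ e : (𝓔₀.comap τ₀).subscheme ≅ 𝓔₀.subscheme, e.hom ≫ 𝓔₀.subschemeι = (𝓔₀.comap τ₀).subschemeι ≫ τ₀) →
      FE F₉ Z₉ hZ₉ F₁₀ υ' G₀ γ₀ E₀ X₀ σ₀ j₀ 𝓔₀ → FE F₉ Z₉ hZ₉ F₁₀ υ' G₀' γ₀' E₀' X₀'' (τ₀ ≫ σ₀) j₀' (𝓔₀.comap τ₀) := by
    intro F₉ Z₉ hZ₉ F₁₀ υ' G₀ G₀' γ₀ γ₀' E₀ E₀' X₀ X₀'' σ₀ j₀ j₀' 𝓔₀ τ₀ he hR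
    exact hFEiso σ₀ 𝓔₀ τ₀ (𝓔₀.comap τ₀) he hR
  -- ===================== THE ROUNDS (the three disjuncts of `TowerRoundBDoublePrime`: A′ round layers …NatTowerBPrimeRoundOfFact + the pair round″) =====================
  have hEmbB := fun {F₉ : Scheme.{0}} (Z₉ : Set F₉) (hZ₉ : IsClosed Z₉) {F₁₀ : Scheme.{0}} (υ' : F₁₀ ⟶ F₉) =>
    Tower.invB_embRound_of_fact_anyPrime O k θ hθ P q Y hYsp hYirr hYcl hPnoeth hPreg Ch hChStep hChSplit hFact Z₉ hZ₉ υ'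
  have hConeB := fun {F₉ : Scheme.{0}} (Z₉ : Set F₉) (hZ₉ : IsClosed Z₉) {F₁₀ : Scheme.{0}} (υ' : F₁₀ ⟶ F₉) =>
    Tower.invB_coneRound_of_anyPrime O k θ hθ P q Y hYirr hYcl hPnoeth hPreg Ch hChStep hChSplit Z₉ hZ₉ υ'
  -- the PAIR round″ (T23-A″; stub-4's …NatTowerBPairRoundOfFact over `Tower.invB_pairRoundCore`), fed with the (A″-1)/(A″-2) v2 bricks by name
  have hPairB := fun {F₉ : Scheme.{0}} (Z₉ : Set F₉) (hZ₉ : IsClosed Z₉) {F₁₀ : Scheme.{0}} (υ' : F₁₀ ⟶ F₉) =>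
    Tower.invB_pairRound_of_fact O k θ hθ P q Y hYirr hYcl hPnoeth hPreg Ch hChStep hChSplit
      (fun {G₀ X₀} _ {σ₀ j₀ t₀ 𝓔₀ 𝓕₀ E₀ F₀ hE₀ hF₀} hXreg hsq₀ hθ₀ hprop hE1 hE2 hF1 hF2 hW1 hW2 hWdim => by
        haveI := hprop; exact isRegular_subscheme_sup_of_trace_crossing hXreg hsq₀ hθ₀ hE1 hE2 hF1 hF2 hW1 hW2 hWdim)
      (fun {G₀ X₀} _ {σ₀ j₀ t₀ 𝓔₀ 𝓕₀ E₀ F₀ hE₀ hF₀} hXreg hsq₀ hθ₀ hprop hE1 hE2 hF1 hF2 hW1 hW2 hWdim => by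
        haveI := hprop; exact flat_subschemeι_sup_of_trace_crossing hXreg hsq₀ hθ₀ hE1 hE2 hF1 hF2 hW1 hW2 hWdim)
      Z₉ hZ₉ υ'
  -- ===================== THE B-DRIVER =====================
  refine hsub_reachTowerBDoublePrime_of_invariant k 3 O θ hθ P q Y Ch hChStep hChSplit hYsp hYirr hYcl hPint hPnoeth hPreg hqprop hqsm X' σ'
    S' hCh' hX'int hX'noeth hX'reg hX'dom F₁ hF₁ j t hsq T₁ hT₁cl hT₁irr hjT₁ x hx U hU s hs hsU hsx hdim hxreg hsoff X₁ τ₁ hτ₁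
    hX₁int hX₁noeth hX₁reg hX₁dom F₂ hF₂ υ hυ j₂ t₂ hsq₂ hcomm hcarrier hirr₂ hCh₁
    -- INV (inner, verbatim from V7/V9) and INV₁B (the B-tower invariant at the datum `FE`)
    (fun W G β T Z K b => (K = ∅ ∧ TCPlus.Inv O k θ P q Y Ch W G β T Z b) ∨
      (TCPlus.InvKCL O k θ P q Y Ch W G β T Z K b ∧ IsClosed K ∧ K ⊆ closure (K \ closure Z) ∧ K ≠ Set.univ ∧ IsClosed Z))
    (fun F₉ Z₉ hZ₉ F₁₀ υ' G γ T E Es K => (Tower.InvB O k θ P q Y Ch FE F₉ Z₉ hZ₉ F₁₀ υ' G γ T E Es K ∧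
      IsClosed K ∧ K ⊆ closure (K \ E) ∧ K ≠ Set.univ) ∧
      (∀ z : ↥(redSub F₉ Z₉ hZ₉), IsClosed ({z} : Set ↥(redSub F₉ Z₉ hZ₉)) →
        ringKrullDim ((redSub F₉ Z₉ hZ₉).presheaf.stalk z) = ((1 : ℕ) : WithBot ℕ∞)) ∧ IsLocallyNoetherian F₉)
    ?_ ?_ ?_ ?_ ?_ ?_ ?_ ?_
  · -- (base)
    intro W K₂ hxW hnot hWpr hZT hK₂
    rcases hK₂ with rfl | ⟨hcone, rfl⟩
    · exact Or.inl ⟨rfl, inv_base k O θ hθ P q Y Ch hChSplit hPnoeth hPreg X' σ' S' hCh' hX'reg F₁ j t hsq T₁ x hx U hU s hs hsU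
        hsx hdim hsoff X₁ τ₁ hτ₁ hX₁reg hX₁dom F₂ υ hυ j₂ t₂ hsq₂ hcomm hcarrier hCh₁ hirr₂ W hxW hnot hWpr⟩
    · refine Or.inr ⟨hBaseKCL W hxW hnot hWpr hcone, isClosed_closure, ?_, ?_, hEx.inter isClosed_closure⟩
      · -- `υ⁻¹(W ∖ {x})` misses the special fibre, hence the closure of `Z₂ ⊆ υ⁻¹{x}`
        have hZcl : closure (υ ⁻¹' {x} ∩ closure (υ ⁻¹' (W \ {x}))) ⊆ υ ⁻¹' {x} :=
          closure_minimal Set.inter_subset_left hEx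
        refine closure_minimal (fun g hg => subset_closure ⟨subset_closure hg, fun h => hg.2 (hZcl h)⟩) isClosed_closure
      · intro huniv
        apply hnot
        rw [huniv]; exact Set.subset_univ _
  · -- (step, flag kept)
    intro W G₁ G₂ β T Z K b y υ₁ hy hI hyT hyreg' hyreg hυ₁
    rcases hI with ⟨rfl, hI⟩ | hI
    · refine Or.inl ⟨by simp, ?_⟩
      exact inv_step_regular O k θ hθ P q Y hYsp hYirr hYcl hPnoeth hPreg Ch hChSplit hChStep W G₁ G₂ β T Z b y υ₁ hy hI hyT
        hyreg' hyreg hυ₁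
    · obtain ⟨hI, hKcl, hKd, hKne, hZcl⟩ := hI
      have hI₂ := invKCL_step_regular O k θ hθ P q Y hYsp hYirr hYcl hPnoeth hPreg Ch hChSplit hChStep W G₁ G₂ β T Z K b y υ₁ hy hI hZcl hyT
        hyreg' hyreg hυ₁
      obtain ⟨hG₁, -, -, hTZ, -⟩ := TCPlus.invKCL_inv O k θ P q Y Ch hI
      haveI := hG₁
      refine Or.inr ⟨hI₂, isClosed_closure, ?_, ?_, isClosed_closure⟩
      · -- dense off the transported curve: through the blow-up of the point (an isomorphism off it)
        have h := closure_preimage_diff_subset_of_isBlowup υ₁ _ hυ₁ K (closure Z) isClosed_closure hKd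
        rw [Scheme.IdealSheafData.coe_support_vanishingIdeal] at h
        refine h.trans (closure_mono fun g hg => ⟨hg.1, fun hg' => hg.2 ?_⟩)
        rw [closure_closure] at hg'
        refine closure_mono (Set.preimage_mono ?_) hg'
        intro z hz
        exact ⟨subset_closure hz.1, hz.2⟩
      · have hyZ : ((vanishingIdeal (⟨closure Z, isClosed_closure⟩ : Closeds G₁)).subschemeι y : G₁) ∈ closure Z := by
          have h1 : ((vanishingIdeal (⟨closure Z, isClosed_closure⟩ : Closeds G₁)).subschemeι y : G₁) ∈
              Set.range (vanishingIdeal (⟨closure Z, isClosed_closure⟩ : Closeds G₁)).subschemeι := ⟨y, rfl⟩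
          rw [Scheme.IdealSheafData.range_subschemeι, Scheme.IdealSheafData.coe_support_vanishingIdeal] at h1
          exact h1
        exact closure_preimage_ne_univ υ₁ _ hυ₁ K {_} hKcl hKne hy
          (fun h => hTZ (fun z _ => by rw [Set.eq_univ_iff_forall] at h; rw [Set.mem_singleton_iff.mp (h z)]; exact hyZ))
          (by rw [Scheme.IdealSheafData.coe_support_vanishingIdeal]; rfl) _ (Set.preimage_mono fun z hz => hz.1)
  · -- (step, flag raised)
    intro W G₁ G₂ β T Z K y υ₁ hy hI hyT hysing hyreg hυ₁
    rcases hI with ⟨rfl, hI⟩ | hI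
    · refine Or.inl ⟨by simp, ?_⟩
      exact inv_step_singular O k θ hθ P q Y hYsp hYirr hYcl hPnoeth hPreg Ch hChSplit hChStep W G₁ G₂ β T Z y υ₁ hy hI hyT
        hysing hyreg hυ₁
    · obtain ⟨hI, hKcl, hKd, hKne, hZcl⟩ := hI
      have hI₂ := invKCL_step_singular O k θ hθ P q Y hYsp hYirr hYcl hPnoeth hPreg Ch hChSplit hChStep W G₁ G₂ β T Z K y υ₁ hy hI hZcl hyT
        hysing hyreg hυ₁
      obtain ⟨hG₁, -, -, hTZ, -⟩ := TCPlus.invKCL_inv O k θ P q Y Ch hI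
      haveI := hG₁
      refine Or.inr ⟨hI₂, isClosed_closure, ?_, ?_, isClosed_closure⟩
      · have h := closure_preimage_diff_subset_of_isBlowup υ₁ _ hυ₁ K (closure Z) isClosed_closure hKd
        rw [Scheme.IdealSheafData.coe_support_vanishingIdeal] at h
        refine h.trans (closure_mono fun g hg => ⟨hg.1, fun hg' => hg.2 ?_⟩)
        rw [closure_closure] at hg'
        refine closure_mono (Set.preimage_mono ?_) hg'
        intro z hz
        exact ⟨subset_closure hz.1, hz.2⟩
      · have hyZ : ((vanishingIdeal (⟨closure Z, isClosed_closure⟩ : Closeds G₁)).subschemeι y : G₁) ∈ closure Z := by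
          have h1 : ((vanishingIdeal (⟨closure Z, isClosed_closure⟩ : Closeds G₁)).subschemeι y : G₁) ∈
              Set.range (vanishingIdeal (⟨closure Z, isClosed_closure⟩ : Closeds G₁)).subschemeι := ⟨y, rfl⟩
          rw [Scheme.IdealSheafData.range_subschemeι, Scheme.IdealSheafData.coe_support_vanishingIdeal] at h1
          exact h1
        exact closure_preimage_ne_univ υ₁ _ hυ₁ K {_} hKcl hKne hy
          (fun h => hTZ (fun z _ => by rw [Set.eq_univ_iff_forall] at h; rw [Set.mem_singleton_iff.mp (h z)]; exact hyZ))
          (by rw [Scheme.IdealSheafData.coe_support_vanishingIdeal]; rfl) _ (Set.preimage_mono fun z hz => hz.1)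
  · -- (curve) at the datum `FE`: res-D-pv-029's GENERIC curve-step bricks, the datum BORN by `flat_exceptional_of_isBlowup_regularCentre`
    intro W F₉ β₉ T₉ Z₉ K₉ b₉ hZ₉ F₁₀ υ' hI hZT hTZ hZinf _hfin hυ'
    have hcar := hcarOfINV W β₉ T₉ Z₉ K₉ b₉ hZ₉ hI
    have hF₉noeth := hnoethOfINV W β₉ T₉ Z₉ K₉ b₉ hI
    have hborn : ∀ (X : Scheme.{0}) (σ : X ⟶ P) (S : Set X) (jG : F₉ ⟶ X) (tG : F₉ ⟶ Spec (.of k)) (𝓢 K : X.IdealSheafData)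
        (X₁₀ : Scheme.{0}) (τ : X₁₀ ⟶ X) (j₁₀ : F₁₀ ⟶ X₁₀) (t₁₀ : F₁₀ ⟶ Spec (.of k)),
        Ch X σ S → IsIntegral X → IsLocallyNoetherian X → Scheme.IsRegular X → IsDominant (σ ≫ q) →
        IsPullback jG tG (σ ≫ q) (Spec.map (CommRingCat.ofHom θ)) → jG '' T₉ = S →
        (𝓢 ⊔ K).comap jG = vanishingIdeal ⟨Z₉, hZ₉⟩ → Flat ((𝓢 ⊔ K).subschemeι ≫ σ ≫ q) → Scheme.IsRegular (𝓢 ⊔ K).subscheme →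
        Scheme.IsRegular 𝓢.subscheme → IsBlowup τ (𝓢 ⊔ K) → IsPullback j₁₀ t₁₀ ((τ ≫ σ) ≫ q) (Spec.map (CommRingCat.ofHom θ)) →
        j₁₀ ≫ τ = υ' ≫ jG →
        FE F₉ Z₉ hZ₉ F₁₀ υ' F₁₀ (𝟙 F₁₀) (υ' ⁻¹' Z₉) X₁₀ (τ ≫ σ) j₁₀ ((𝓢 ⊔ K).comap τ) := by
      intro X σ S jG tG 𝓢 K X₁₀ τ j₁₀ t₁₀ _ _ hXnoeth hXreg _ _ _ _ hCflat hCreg _ hτ _ _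
      haveI := hXnoeth
      exact hFEbirth σ (𝓢 ⊔ K) τ hXreg hCreg hCflat hτ
    rcases hI with ⟨hK, hI⟩ | ⟨hI, hKcl, hKd, hKne, -⟩
    · have h := Tower.inv₂_inv₃ O k θ P q Y Ch FE F₉ Z₉ hZ₉ F₁₀ υ' F₁₀ (𝟙 F₁₀) _ _ _
        (Tower.inv₂_of_inv_curveStep_forget O k θ hθ P q Y hYirr hYcl hPnoeth hPreg Ch hChSplit hChStep FE W F₉ β₉ T₉ Z₉ K₉ b₉
          hZ₉ F₁₀ υ' hI hZinf hK hZT hTZ hυ' hborn)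
      subst hK
      refine ⟨⟨Tower.invB_nil_of_inv₃ O k θ P q Y Ch FE F₉ Z₉ hZ₉ F₁₀ υ' _ _ _ _ _ h, isClosed_closure, by simp, ?_⟩, hcar, hF₉noeth⟩
      obtain ⟨-, -, hF₁₀, -⟩ := h
      haveI := hF₁₀
      rw [show closure (υ' ⁻¹' (∅ \ Z₉)) = ∅ by simp]
      exact Set.empty_ne_univ
    · obtain ⟨hG, -⟩ := TCPlus.invKCL_inv O k θ P q Y Ch hI
      haveI := hG
      have h := Tower.inv₃_of_invKCL_curveStep O k θ hθ P q Y hYirr hYcl hPnoeth hPreg Ch hChSplit hChStep FE W F₉ β₉ T₉ Z₉ K₉ b₉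
        hZ₉ F₁₀ υ' hI hZinf hKcl hKne (hKd.trans (closure_mono fun z hz => ⟨hz.1, fun h => hz.2 (subset_closure h)⟩)) hZT hTZ hυ'
        hborn
      refine ⟨⟨Tower.invB_nil_of_inv₃ O k θ P q Y Ch FE F₉ Z₉ hZ₉ F₁₀ υ' _ _ _ _ _ h, isClosed_closure, ?_, ?_⟩, hcar, hF₉noeth⟩
      · have := closure_preimage_diff_subset_closure_diff_preimage υ' K₉ Z₉
        exact this
      · obtain ⟨-, -, -, hTcl, hTirr, -⟩ := h
        refine closure_preimage_ne_univ υ' _ hυ' K₉ Z₉ hKcl hKne hZ₉ (fun h => hTZ (h ▸ Set.subset_univ _))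
          (by rw [Scheme.IdealSheafData.coe_support_vanishingIdeal]; rfl) _ (Set.preimage_mono fun z hz => hz.1)
  · -- (pt-reg) …NatTowerBPointSteps at `FE`, every retained member through the same section blow-up (B-AWAY)
    intro F₉ Z₉ hZ₉ F₁₀ υ' G G' γ T E Es K y υ₂ hy K' E' Es' hinv hTreg hGreg hυ₂ hK' hE' hEs'
    obtain ⟨⟨hinv, hKcl, hKE, hKne⟩, hcar, hF₉noeth⟩ := hinv
    have hI₂ := Tower.towerPtRegB_invB O k θ hθ P q Y hYsp hYirr hYcl hPnoeth hPreg Ch hChSplit hChStep FE F₉ Z₉ hZ₉ F₁₀ υ'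
      (hFEisoC Z₉ hZ₉ υ') G G' γ T E Es K y υ₂ hy K' E' Es' hinv hTreg hGreg hυ₂ hK' hE' hEs'
    refine (fun h3 => ⟨⟨hI₂, h3⟩, hcar, hF₉noeth⟩) ?_
    obtain ⟨-, -, hGint, -, hTirr, hEcl, hTE, -⟩ := hinv
    obtain ⟨-, -, hG'int, -⟩ := hI₂
    haveI := hGint
    haveI := hG'int
    have hTy : ¬ T ⊆ {curvePt G T y} := not_subset_singleton_of_not_isRegularLocalRing_stalk y hTreg hy
    have hDsupp : ((vanishingIdeal (⟨{curvePt G T y}, hy⟩ : Closeds G) : G.IdealSheafData).support : Set G) = {curvePt G T y} :=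
      Scheme.IdealSheafData.coe_support_vanishingIdeal _
    rcases hK' with rfl | ⟨hyK, rfl⟩
    · exact ⟨isClosed_empty, by simp, Set.empty_ne_univ⟩
    · refine ⟨isClosed_closure, ?_, closure_preimage_ne_univ υ₂ _ hυ₂ K {curvePt G T y} hKcl hKne hy
        (fun h => hTy (h ▸ Set.subset_univ _)) hDsupp.le _ (Set.preimage_mono fun z hz => hz.1)⟩
      rcases hE' with rfl | ⟨-, rfl⟩
      · exact closure_preimage_diff_subset_closure_diff_preimage υ₂ K {curvePt G T y}
      · have h := closure_preimage_diff_subset_of_isBlowup υ₂ (vanishingIdeal (⟨{curvePt G T y}, hy⟩ : Closeds G)) hυ₂ K E hEcl hKE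
        rw [hDsupp] at h
        exact h
  · -- (pt-ram)
    intro F₉ Z₉ hZ₉ F₁₀ υ' G G' γ T E Es K y J υ₂ K' E' Es' hinv hTreg hGreg hJsupp hJgen hυ₂ hK' hE' hEs'
    obtain ⟨⟨hinv, hKcl, hKE, hKne⟩, hcar, hF₉noeth⟩ := hinv
    have hI₂ := Tower.towerPtRamB_invB O k θ hθ P q Y hYsp hYirr hYcl hPnoeth hPreg Ch hChSplit hChStep FE F₉ Z₉ hZ₉ F₁₀ υ'
      (hFEisoC Z₉ hZ₉ υ') G G' γ T E Es K y J υ₂ K' E' Es' hinv hTreg hGreg hJsupp hJgen hυ₂ hK' hE' hEs'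
    refine (fun h3 => ⟨⟨hI₂, h3⟩, hcar, hF₉noeth⟩) ?_
    obtain ⟨-, -, hGint, -, hTirr, hEcl, hTE, -⟩ := hinv
    obtain ⟨-, -, hG'int, -⟩ := hI₂
    haveI := hGint
    haveI := hG'int
    have hyc : IsClosed ({curvePt G T y} : Set G) := hJsupp ▸ J.support.isClosed
    have hTy : ¬ T ⊆ {curvePt G T y} := not_subset_singleton_of_not_isRegularLocalRing_stalk y hTreg hyc
    rcases hK' with rfl | ⟨hyK, rfl⟩
    · exact ⟨isClosed_empty, by simp, Set.empty_ne_univ⟩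
    · refine ⟨isClosed_closure, ?_, closure_preimage_ne_univ υ₂ _ hυ₂ K {curvePt G T y} hKcl hKne hyc
        (fun h => hTy (h ▸ Set.subset_univ _)) hJsupp.le _ (Set.preimage_mono fun z hz => hz.1)⟩
      rcases hE' with rfl | ⟨-, rfl⟩
      · exact closure_preimage_diff_subset_closure_diff_preimage υ₂ K {curvePt G T y}
      · have h := closure_preimage_diff_subset_of_isBlowup υ₂ J hυ₂ K E hEcl hKE
        rw [hJsupp] at h
        exact h
  · -- (round) `TowerRoundBPrime`: disjunct 1 (host = the running surface, ₅ admission verbatim) and disjunct 2 (host = a retained member)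
    intro F₉ Z₉ hZ₉ F₁₀ υ' G G' γ T E Es K hE Z hZ Hst W υ₂ K' E' Es' hinv hZT hZne hfull hadm hυ₂ hEs'
    obtain ⟨hI, hcar, hF₉noeth⟩ := hinv
    haveI := hF₉noeth
    have hGint : IsIntegral G := hI.1.2.2.1
    haveI := hGint
    haveI : IsLocallyNoetherian G := by
      obtain ⟨-, -, -, -, -, -, -, -, X, σ, S, jG, tG, -, -, hXnoeth, -, -, hsq, -, -⟩ := hI.1
      haveI := hXnoeth
      haveI : IsClosedImmersion (Spec.map (CommRingCat.ofHom θ)) := IsClosedImmersion.spec_of_surjective _ hθ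
      haveI : IsClosedImmersion jG := MorphismProperty.IsStableUnderBaseChange.of_isPullback hsq.flip inferInstance
      exact LocallyOfFiniteType.isLocallyNoetherian jG
    rcases hadm with ⟨hWH, hHst, hZE, hadm, hE', hK'⟩ | ⟨hWH, hHmem, hF, hZH, hirr, hZreg, hGreg, hHZreg, hunobs, hE', hK'⟩ |
      ⟨hHmem, hWmem, hHW, hH, hW, hpair, hZreg, hE', hK'⟩
    · -- disjunct 1: host = the running surface `E` (shadow `K`); witness = host
      subst W
      subst hHst
      replace hEs' : ∀ F' ∈ Es', ∃ F ∈ Hst :: Es, RoundTransportOKPrime υ₂ Z hZ Hst F F' := fun F' hF' =>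
        let ⟨F, hF, h⟩ := hEs' F' hF'; ⟨F, hF, roundTransportOKPrime_of_roundTransportOKDoublePrime_self h⟩
      have hZET : Z ⊆ Hst ∩ T := fun z hz => ⟨hZE hz, hZT hz⟩
      rcases hadm with ⟨hsec, hcech | hcone⟩ | ⟨-, hZreg, -, hEZreg, hunobs⟩
      · -- a SECTION round, Čech-witnessed: `Z̃ ≅ Z̃₉ ≅ ℙ¹`
        obtain ⟨hrat₉, -, hEZreg, hunobs⟩ := hcech
        have hZrat : RationalCarrier (redSub G Z hZ) := rationalCarrier_of_dirStepSec hsec hrat₉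
        have hZreg := isRegularLocalRing_stalk_of_rationalCarrier hZrat
        have hZdim := ringKrullDim_redSub_stalk_eq_of_dirStepSec hsec hcar
        rcases hK' with hK0 | ⟨hcone | hoff, hKst⟩
        · exact (fun h => ⟨h, hcar, hF₉noeth⟩) (hEmbB Z₉ hZ₉ υ' G G' γ T Hst Es K Hst K hE Z hZ υ₂ K' E' Es' hI (Or.inl ⟨rfl, rfl⟩) hZET hZne
            hfull hZreg hEZreg hunobs hZdim hυ₂ (Or.inl hK0) hE' hEs')
        · exact (fun h => ⟨h, hcar, hF₉noeth⟩) (hConeB Z₉ hZ₉ υ' G G' γ T Hst Es K hE Z hZ υ₂ K' E' Es' hI hZET hZne hfull hcone hυ₂ (Or.inr hKst)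
            hE' hEs')
        · exact (fun h => ⟨h, hcar, hF₉noeth⟩) (hEmbB Z₉ hZ₉ υ' G G' γ T Hst Es K Hst K hE Z hZ υ₂ K' E' Es' hI (Or.inl ⟨rfl, rfl⟩) hZET hZne
            hfull hZreg hEZreg hunobs hZdim hυ₂ (Or.inr ⟨hoff, hKst⟩) hE' hEs')
      · -- a SECTION round, cone-witnessed
        have hK'' : K' = ∅ ∨ K' = closure (υ₂ ⁻¹' (K \ Z)) := by
          rcases hK' with h | ⟨-, h⟩
          · exact Or.inl h
          · exact Or.inr h
        exact (fun h => ⟨h, hcar, hF₉noeth⟩) (hConeB Z₉ hZ₉ υ' G G' γ T Hst Es K hE Z hZ υ₂ K' E' Es' hI hZET hZne hfull hcone hυ₂ hK'' hE' hEs')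
      · -- a GENUS-FREE MULTISECTION round: `Z̃` regular of dimension 1 by (B3)
        have hZdim := ringKrullDim_redSub_stalk_eq_one_of_towerFull hfull hcar
        rcases hK' with hK0 | ⟨hcone | hoff, hKst⟩
        · exact (fun h => ⟨h, hcar, hF₉noeth⟩) (hEmbB Z₉ hZ₉ υ' G G' γ T Hst Es K Hst K hE Z hZ υ₂ K' E' Es' hI (Or.inl ⟨rfl, rfl⟩) hZET hZne
            hfull hZreg hEZreg hunobs hZdim hυ₂ (Or.inl hK0) hE' hEs')
        · exact (fun h => ⟨h, hcar, hF₉noeth⟩) (hConeB Z₉ hZ₉ υ' G G' γ T Hst Es K hE Z hZ υ₂ K' E' Es' hI hZET hZne hfull hcone hυ₂ (Or.inr hKst)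
            hE' hEs')
        · exact (fun h => ⟨h, hcar, hF₉noeth⟩) (hEmbB Z₉ hZ₉ υ' G G' γ T Hst Es K Hst K hE Z hZ υ₂ K' E' Es' hI (Or.inl ⟨rfl, rfl⟩) hZET hZne
            hfull hZreg hEZreg hunobs hZdim hυ₂ (Or.inr ⟨hoff, hKst⟩) hE' hEs')
    · -- disjunct 2: host = a RETAINED member `Hst ∈ Es` (shadow `∅`), new running surface `υ₂⁻¹Z`; witness = host
      subst W
      replace hEs' : ∀ F' ∈ Es', ∃ F ∈ E :: Es, RoundTransportOKPrime υ₂ Z hZ Hst F F' := fun F' hF' =>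
        let ⟨F, hF, h⟩ := hEs' F' hF'; ⟨F, hF, roundTransportOKPrime_of_roundTransportOKDoublePrime_self h⟩
      have hZHT : Z ⊆ Hst ∩ T := fun z hz => ⟨hZH hz, hZT hz⟩
      have hTHst : ¬ T ⊆ Hst := (hI.1.2.2.2.2.2.2.2.1 Hst hHmem).2
      have hZdim := ringKrullDim_redSub_stalk_eq_one_of_towerFull hfull hcar
      obtain ⟨hB₀, -, -, -⟩ := hEmbB Z₉ hZ₉ υ' G G' γ T E Es K Hst ∅ hF Z hZ υ₂ ∅ E' Es' hI (Or.inr ⟨hHmem, rfl⟩) hZHT hZne hfull hZreg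
        hHZreg hunobs hZdim hυ₂ (Or.inl rfl) (Or.inl hE') hEs'
      subst hE'
      have hG'int : IsIntegral G' := hB₀.2.2.1
      haveI := hG'int
      rcases hK' with rfl | ⟨hZK, rfl⟩
      · exact ⟨⟨hB₀, isClosed_empty, Set.empty_subset _, Set.empty_ne_univ⟩, hcar, hF₉noeth⟩
      · obtain ⟨-, hKcl, -, hKne⟩ := hI
        have hZsupp : ((vanishingIdeal (⟨Z, hZ⟩ : Closeds G) : G.IdealSheafData).support : Set G) = Z :=
          Scheme.IdealSheafData.coe_support_vanishingIdeal _
        have hTZ : ¬ T ⊆ Z := fun h => hTHst (h.trans hZH)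
        -- the new running surface misses the transported shadow
        have hsub : closure (υ₂ ⁻¹' (K \ Z)) ⊆ υ₂ ⁻¹' closure K :=
          closure_minimal (fun z hz => subset_closure hz.1) (isClosed_closure.preimage υ₂.continuous)
        have hEK : Disjoint (υ₂ ⁻¹' Z) (closure (closure (υ₂ ⁻¹' (K \ Z)))) := by
          rw [closure_closure]
          refine Set.disjoint_left.mpr fun z hzZ hzK => ?_
          exact (Set.disjoint_left.mp hZK) hzZ (hsub hzK)
        refine ⟨⟨Tower.invB_shadow_of_disjoint O k θ P q Y Ch FE F₉ Z₉ hZ₉ F₁₀ υ' G' (υ₂ ≫ γ) _ _ Es' _ hB₀ hEK, isClosed_closure, ?_, ?_⟩,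
          hcar, hF₉noeth⟩
        · refine closure_minimal (fun z hz => subset_closure ⟨subset_closure hz, fun hzZ => ?_⟩) isClosed_closure
          exact (Set.disjoint_left.mp hEK) hzZ (subset_closure (subset_closure hz))
        · exact closure_preimage_ne_univ υ₂ _ hυ₂ K Z hKcl hKne hZ (fun h => hTZ (h ▸ Set.subset_univ _)) hZsupp.le _
            (Set.preimage_mono fun z hz => hz.1)
    · -- disjunct 3 (T23-A″): the PAIR ROUND — centre `Z = Hst ∩ W` of two retained members; menu dispatch …PairArm over stub-4's round″
      have hZdim := ringKrullDim_redSub_stalk_eq_one_of_towerFull hfull hcar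
      subst hE'
      exact ⟨Tower.invB_pairDisjunct_of_supplier O k θ P q Y Ch FE Z₉ hZ₉ υ' G G' γ T E Es K Z hZ Hst W υ₂ K' Es' hI hHmem hWmem hHW hH hW
          hpair hυ₂ hK' hEs' fun H KH hH' W' hW' K'' hhost hW'mem _ hcw hK'' hEs'' =>
          (hPairB Z₉ hZ₉ υ' G G' γ T E Es K H KH hH' Z hZ W' hW' υ₂ K'' _ Es' hI hhost hW'mem hcw hZT hZne hfull hZreg hZdim hυ₂ hK''
            (Or.inl rfl) fun F' hF' => hEs'' F' hF').1, hcar, hF₉noeth⟩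
  · -- (final)
    intro F₉ Z₉ hZ₉ F₁₀ υ' G γ T E Es K h
    exact Tower.invB_final O k θ P q Y Ch FE F₉ Z₉ hZ₉ F₁₀ υ' G γ T E Es K h.1.1

end Summit.ResolutionOfSingularities.ResolutionOfSingularities.Cruxes.EquisingularLiftNat.Sections

end
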